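import Literature.ModelTheory.ExponentialFields.Wilkie1996DclClaim
import Literature.ModelTheory.ExponentialFields.Wilkie1996Lemma93Valuation
import Literature.ModelTheory.ExponentialFields.Wilkie1996ValuationStep
import HarnessLib

/-!
# Wilkie 1996, §§9–11: the boundedness leaf from the valuation-rank bound for finitely generated `e`-definable closures

Topic `Literature/ModelTheory/ExponentialFields`.  `Wilkie1996Lemma93Valuation.lean` proves the
boundedness leaf `Wilkie1996_expPolynomialPoints_bounded` (hence Wilkie's theorem,
`wilkie_isModelComplete`) from the hypothesis `hVR`: for every non-singular zero `ᾱ ∈ Kⁿ` of a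
square system from `Mˢₙ` over a submodel `k ⊆ K` there is a subfield `S ∋ f(k), ᾱ_s, exp ᾱ_s`
of `K` of valuative rank at most `|s|` over `f(k)` (any `|s| + 1` non-zero elements of `S` are
multiplicatively dependent over the integers modulo `f(k)^×` and the units of the valuation ring
of `K`).  `Wilkie1996DclClaim.lean` (den Besten 2016, Lemma 7.2.4, Claim) provides the subfield:
`k* = Dcl_e(f(k) ∪ B)` for a set `B` of at most `|s|` of the values `αⱼ`, `exp αⱼ`, computed in the
language `L_e` of `T_e` (`ETheory.lean`).  **This file performs that substitution**, so that the
only remaining hypothesis is a statement about the theory `T_e` alone, in the form in which the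
valuation inequality delivers it (den Besten, Theorems 7.1.21–7.1.23 applied to
`k' ≼ Dcl_e(k' ∪ B)`, `dim_{k'} Dcl_e(k' ∪ B) ≤ |B|`; Wilkie 1996, Theorems 10.3–10.4 and §11):

> `hV`: for all models `k ⊆ K` of `T_exp` (embedding `f`) and every finite `B ⊆ K`, any
> `|B| + 1` non-zero elements of `Dcl_e(f(k) ∪ B)` are multiplicatively dependent over `ℤ`
> modulo `f(k)^×` and the units of the valuation ring of `K`
> (**the valuative rank of `Dcl_e(f(k) ∪ B)` over `f(k)` is at most `|B|`**).

* `RealExpModel.DclClaim.inv_mem_definableClosure` — `dcl` in an expansion of an ordered field is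
  closed under inverses (with `add/mul/neg`: it is a subfield);
* `Wilkie1996_expPolynomialPoints_bounded_of_dclValRank` — the leaf from `hV`;
  `wilkie_isModelComplete_of_dclValRank`, `Wilkie1996_realExp_modelsExistentiallyClosed_of_dclValRank`,
  `wilkie_isOMinimal_of_dclValRank` — Wilkie's theorem and its corollaries from `hV`.

`hV` is what (V1)–(V3) of `Wilkie1996.lean` (model completeness, o-minimality and polynomial
bounds of `T_e`, and the valuation inequality) establish; nothing here is a named fact and no
definition is introduced.

## References

* A. J. Wilkie, *Model completeness results for expansions of the ordered field of real numbers by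
  restricted Pfaffian functions and the exponential function*, J. Amer. Math. Soc. 9 (1996),
  1051–1094: §9 (9.3, p. 1084), §10 (Theorems 10.3, 10.4), §11. [WilkieJAMS1996]
* M. den Besten, *Wilkie's Theorem and the Uniform Real Schanuel Conjecture*, MSc thesis, Utrecht
  (2016): Theorems 7.1.21–7.1.23, Lemma 7.2.4 and the proof of (36). [DenBesten2016]
-/

noncomputable section

open FirstOrder FirstOrder.Language FirstOrder.Language.Structure
open MvPolynomial

namespace Literature.ModelTheory.ExponentialFields

namespace RealExpModel

variable {k K : Language.Theory.ModelType.{0, 0, 0} realExpTheory}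

namespace DclClaim

variable {L' : FirstOrder.Language.{0, 0}} [L'.Structure K] (φ : Language.orderedRing →ᴸ L') [φ.IsExpansionOn K]
variable {A : Set K}

include φ in
/-- The graph of `x ↦ x⁻¹` (with `0⁻¹ = 0`) is definable: `y = x⁻¹ ↔ x y = 1 ∨ (x = 0 ∧ y = 0)`.
[folklore] -/
theorem definable_graph_inv : A.Definable L' {w : Fin 2 → K | w 1 = (w 0)⁻¹} := by
  have h1 : A.Definable L' {w : Fin 2 → K | w 0 * w 1 = 1} :=
    (definableFun_mul φ (Set.DefinableFun.proj L') (Set.DefinableFun.proj L')).setOf_eq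
      (definableFun_one φ)
  have h2 : A.Definable L' {w : Fin 2 → K | w 0 = 0} :=
    (Set.DefinableFun.proj L').setOf_eq (definableFun_zero φ)
  have h3 : A.Definable L' {w : Fin 2 → K | w 1 = 0} :=
    (Set.DefinableFun.proj L').setOf_eq (definableFun_zero φ)
  convert h1.union (h2.inter h3) using 1
  ext w
  simp only [Set.mem_setOf_eq, Set.mem_union, Set.mem_inter_iff]
  constructor
  · intro hw
    by_cases h0 : w 0 = 0
    · exact Or.inr ⟨h0, by rw [hw, h0, inv_zero]⟩
    · exact Or.inl (by rw [hw, mul_inv_cancel₀ h0])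
  · rintro (hw | ⟨h0, h1'⟩)
    · exact (inv_eq_of_mul_eq_one_right hw).symm
    · rw [h1', h0, inv_zero]

include φ in
/-- `dcl(A)` is closed under inverses. [folklore] -/
theorem inv_mem_definableClosure {a : K} (ha : a ∈ definableClosure L' A) :
    a⁻¹ ∈ definableClosure L' A :=
  apply_mem_definableClosure (f := fun x : K => x⁻¹) (definable_graph_inv φ) ha

end DclClaim

open DclClaim in
/-- **The valuation-rank hypothesis `hVR` of `Wilkie1996Lemma93Valuation.lean` from the bound for
`e`-definable closures**: given `hV`, for every non-singular zero `ᾱ` of a square system from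
`Mˢₙ` over `k ⊆ K` the subfield `k* = Dcl_e(f(k) ∪ B)` of `Wilkie1996DclClaim.lean`
(`RealExpModel.IsMsZero.exists_kstar_orderedERing`, `|B| ≤ |s|`) contains `f(k)`, `ᾱ`,
`exp ᾱ_s` and has valuative rank at most `|s|` over `f(k)` (a dependence among `|B| + 1` of any
`|s| + 1` given elements is one among all of them). [cite: DenBesten2016, Lemma 7.2.4] -/
theorem IsMsZero.exists_subfield_valRank
    (hV : ∀ (k K : Language.Theory.ModelType.{0, 0, 0} realExpTheory)
      (f : k ↪[Language.orderedExpRing] K) (B : Finset K) (x : Fin (B.card + 1) → K),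
      (∀ j, x j ∈ definableClosure Language.orderedERing (Set.range f ∪ ↑B)) → (∀ j, x j ≠ 0) →
        ∃ e : Fin (B.card + 1) → ℤ, e ≠ 0 ∧ ∃ c : k, c ≠ 0 ∧ IsVUnit (f c * ∏ j, x j ^ e j))
    {f : k ↪[Language.orderedExpRing] K} {n : ℕ} {s : Finset (Fin n)}
    {P : Fin n → MvPolynomial (MsVar n) k} {α : Fin n → K} (h : IsMsZero f s P α) :
    ∃ S : Subfield K, (∀ b : k, f b ∈ S) ∧ (∀ i ∈ s, α i ∈ S) ∧ (∀ i ∈ s, exp (α i) ∈ S) ∧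
      ∀ x : Fin (s.card + 1) → K, (∀ j, x j ∈ S) → (∀ j, x j ≠ 0) →
        ∃ e : Fin (s.card + 1) → ℤ, e ≠ 0 ∧ ∃ c : k, c ≠ 0 ∧ IsVUnit (f c * ∏ j, x j ^ e j) := by
  classical
  obtain ⟨B, hB, -, -, hα, hexp⟩ := h.exists_kstar_orderedERing
  let φe : Language.orderedRing →ᴸ Language.orderedERing := LHom.sumInl
  let D : Set K := definableClosure Language.orderedERing (Set.range f ∪ ↑B)
  let S : Subfield K :=
    { carrier := D
      mul_mem' := fun ha hb => mul_mem_definableClosure φe ha hb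
      one_mem' := one_mem_definableClosure φe
      add_mem' := fun ha hb => add_mem_definableClosure φe ha hb
      zero_mem' := zero_mem_definableClosure' φe
      neg_mem' := fun ha => neg_mem_definableClosure φe ha
      inv_mem' := fun _ ha => inv_mem_definableClosure φe ha }
  refine ⟨S, fun b => subset_definableClosure _ (Or.inl ⟨b, rfl⟩), fun i _ => hα i, hexp, ?_⟩
  intro x hx hx0
  -- restrict to the first `|B| + 1` elements
  have hle : B.card + 1 ≤ s.card + 1 := by omega
  let ι : Fin (B.card + 1) → Fin (s.card + 1) := Fin.castLE hle
  have hι : Function.Injective ι := Fin.castLE_injective hle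
  obtain ⟨e, he, c, hc, hunit⟩ := hV k K f B (x ∘ ι) (fun j => hx _) (fun j => hx0 _)
  refine ⟨Function.extend ι e 0, ?_, c, hc, ?_⟩
  · intro h0
    apply he
    funext j
    have := congrFun h0 (ι j)
    rwa [hι.extend_apply] at this
  · have hprod : ∏ j, x j ^ Function.extend ι e 0 j = ∏ j, (x ∘ ι) j ^ e j := by
      rw [← Finset.prod_subset (Finset.subset_univ (Finset.univ.image ι))]
      · rw [Finset.prod_image fun a _ b _ hab => hι hab]
        exact Finset.prod_congr rfl fun j _ => by rw [hι.extend_apply]; rfl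
      · intro j _ hj
        have hj' : ¬ ∃ a, ι a = j := by simpa [Finset.mem_image] using hj
        rw [Function.extend_apply' _ _ _ hj', Pi.zero_apply, zpow_zero]
    rwa [hprod]

/-- **The boundedness leaf (`Wilkie1996_expPolynomialPoints_bounded`, Wilkie 1996, §9) from the
valuative-rank bound for finitely generated `e`-definable closures** — through
`RealExpModel.IsMsZero.exists_subfield_valRank` and
`Wilkie1996_expPolynomialPoints_bounded_of_valRank`. [cite: WilkieJAMS1996, §§9–11]
[cite: DenBesten2016, Theorem 7.1.23 and Lemma 7.2.4] -/
theorem _root_.Literature.ModelTheory.ExponentialFields.Wilkie1996_expPolynomialPoints_bounded_of_dclValRank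
    (hV : ∀ (k K : Language.Theory.ModelType.{0, 0, 0} realExpTheory)
      (f : k ↪[Language.orderedExpRing] K) (B : Finset K) (x : Fin (B.card + 1) → K),
      (∀ j, x j ∈ definableClosure Language.orderedERing (Set.range f ∪ ↑B)) → (∀ j, x j ≠ 0) →
        ∃ e : Fin (B.card + 1) → ℤ, e ≠ 0 ∧ ∃ c : k, c ≠ 0 ∧ IsVUnit (f c * ∏ j, x j ^ e j)) :
    Wilkie1996_expPolynomialPoints_bounded :=
  Wilkie1996_expPolynomialPoints_bounded_of_valRank fun _ _ _ _ _ _ _ h =>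
    h.exists_subfield_valRank hV

/-- **Wilkie's theorem (`wilkie_isModelComplete`) from the valuative-rank bound for finitely
generated `e`-definable closures.** [cite: WilkieJAMS1996, Second Main Theorem and §§9–11] -/
theorem _root_.Literature.ModelTheory.ExponentialFields.wilkie_isModelComplete_of_dclValRank
    (hV : ∀ (k K : Language.Theory.ModelType.{0, 0, 0} realExpTheory)
      (f : k ↪[Language.orderedExpRing] K) (B : Finset K) (x : Fin (B.card + 1) → K),
      (∀ j, x j ∈ definableClosure Language.orderedERing (Set.range f ∪ ↑B)) → (∀ j, x j ≠ 0) →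
        ∃ e : Fin (B.card + 1) → ℤ, e ≠ 0 ∧ ∃ c : k, c ≠ 0 ∧ IsVUnit (f c * ∏ j, x j ^ e j)) :
    wilkie_isModelComplete :=
  wilkie_isModelComplete_of_expPolynomialPoints_bounded
    (Wilkie1996_expPolynomialPoints_bounded_of_dclValRank hV)

/-- **The models of `T_exp` are existentially closed in one another
(`Wilkie1996_realExp_modelsExistentiallyClosed`, Wilkie 1996, §9, p. 1083) from the
valuative-rank bound for finitely generated `e`-definable closures.**
[cite: WilkieJAMS1996, §9 (p. 1083) and §§10–11] -/
theorem _root_.Literature.ModelTheory.ExponentialFields.Wilkie1996_realExp_modelsExistentiallyClosed_of_dclValRank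
    (hV : ∀ (k K : Language.Theory.ModelType.{0, 0, 0} realExpTheory)
      (f : k ↪[Language.orderedExpRing] K) (B : Finset K) (x : Fin (B.card + 1) → K),
      (∀ j, x j ∈ definableClosure Language.orderedERing (Set.range f ∪ ↑B)) → (∀ j, x j ≠ 0) →
        ∃ e : Fin (B.card + 1) → ℤ, e ≠ 0 ∧ ∃ c : k, c ≠ 0 ∧ IsVUnit (f c * ∏ j, x j ^ e j)) :
    Wilkie1996_realExp_modelsExistentiallyClosed :=
  Wilkie1996_realExp_modelsExistentiallyClosed_of_expPolynomialPoints_bounded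
    (Wilkie1996_expPolynomialPoints_bounded_of_dclValRank hV)

/-- **O-minimality of `ℝ_exp` (`wilkie_isOMinimal`) from the valuative-rank bound for finitely
generated `e`-definable closures.** [cite: WilkieJAMS1996, Second Main Theorem and §§9–11] -/
theorem _root_.Literature.ModelTheory.ExponentialFields.wilkie_isOMinimal_of_dclValRank
    (hV : ∀ (k K : Language.Theory.ModelType.{0, 0, 0} realExpTheory)
      (f : k ↪[Language.orderedExpRing] K) (B : Finset K) (x : Fin (B.card + 1) → K),
      (∀ j, x j ∈ definableClosure Language.orderedERing (Set.range f ∪ ↑B)) → (∀ j, x j ≠ 0) →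
        ∃ e : Fin (B.card + 1) → ℤ, e ≠ 0 ∧ ∃ c : k, c ≠ 0 ∧ IsVUnit (f c * ∏ j, x j ^ e j)) :
    wilkie_isOMinimal :=
  wilkie_isOMinimal_of_expPolynomialPoints_bounded
    (Wilkie1996_expPolynomialPoints_bounded_of_dclValRank hV)

end RealExpModel

end Literature.ModelTheory.ExponentialFields
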